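import Summits.Ventures.PercRepro.RankLevelSetLevelTenInfraGXT

/-!
# PercRepro — THE LARGE-CORANK STEPS AT LEVEL `10`: the two steps of the inequality
`2^{p+639}·C(n, 10)/C(p+10, 10) + R₁₀(n) ≤ Σ_{10 ≤ k ≤ p−1} C(n, k)` (p2, gen 35; a feeder for S4 — the top of the `q = 10`
window, from `1,088`)

The level-`10` instance of p2 g34's RankLevelSetCoreNineLargeCorankArith (same proofs): `R₁₀(n)` = the rank-`≤ 10` sets through
the flat bounds `639 / 319 / 159 / 79 / 39 / 19 / 10 / 6 / 3 / 1`; `largeTen_step_n` (monotone in `n`: every left term grows by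
at most `(n + 1)/(n − 9)`, every right term by at least it) and `largeTen_step_p` (doubling along `n = p + D`:
`(n + 1)(p + 1) ≤ (n − 9)(p + 11)`, `R₁₀(n + 1) ≤ 2·R₁₀(n)`, Pascal on the mid sum). The base and `largeTen_all_gxt` are in
RankLevelSetCoreTenLargeCorankGXT. Axioms: standard.
-/

set_option exponentiation.threshold 1024

namespace PercRepro

namespace ThmN

open Set

/-- `C(n+1, k)·(n − 9) ≤ C(n, k)·(n + 1)` for `k ≤ 10` (`C(n, k)(n + 1) = C(n+1, k)(n + 1 − k)`). -/
theorem choose_succ_mul_sub_nine_le (n k : ℕ) (hk : k ≤ 10) :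
    (n + 1).choose k * (n - 9) ≤ n.choose k * (n + 1) := by
  have h := Nat.choose_mul_succ_eq n k
  calc (n + 1).choose k * (n - 9) ≤ (n + 1).choose k * (n + 1 - k) := Nat.mul_le_mul_left _ (by omega)
    _ = n.choose k * (n + 1) := h.symm

/-- `C(n, k)·(n + 1) ≤ C(n+1, k)·(n − 9)` for `10 ≤ k`. -/
theorem choose_mul_succ_le_choose_succ_mul_sub_nine (n k : ℕ) (hk : 10 ≤ k) :
    n.choose k * (n + 1) ≤ (n + 1).choose k * (n - 9) := by
  have h := Nat.choose_mul_succ_eq n k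
  calc n.choose k * (n + 1) = (n + 1).choose k * (n + 1 - k) := h
    _ ≤ (n + 1).choose k * (n - 9) := Nat.mul_le_mul_left _ (by omega)

/-- `C(n+1, 10)·(n − 9) = C(n, 10)·(n + 1)` for `n ≥ 10`. -/
theorem choose_succ_ten_mul_sub_nine (n : ℕ) (hn : 10 ≤ n) :
    (n + 1).choose 10 * (n - 9) = n.choose 10 * (n + 1) := by
  have h := Nat.choose_mul_succ_eq n 10
  rw [show n + 1 - 10 = n - 9 by omega] at h
  exact h.symm

/-- **The flat tail `R₁₀` grows by at most the factor `(n + 1)/(n − 9)`**: `R₁₀(n+1)·(n − 9) ≤ R₁₀(n)·(n + 1)`. -/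
theorem flatTail_ten_succ_mul_sub_nine_le (n : ℕ) :
    ((n + 1).choose 10 * 2 ^ 629 + (n + 1).choose 9 * 2 ^ 310 + (n + 1).choose 8 * 2 ^ 151 + (n + 1).choose 7 * 2 ^ 72 + (n + 1).choose 6 * 2 ^ 33 + (n + 1).choose 5 * 2 ^ 14 + (n + 1).choose 4 * 2 ^ 6 +
      (n + 1).choose 3 * 2 ^ 3 + (n + 1).choose 2 * 2 + (n + 1) + 1) * (n - 9) ≤
    (n.choose 10 * 2 ^ 629 + n.choose 9 * 2 ^ 310 + n.choose 8 * 2 ^ 151 + n.choose 7 * 2 ^ 72 + n.choose 6 * 2 ^ 33 + n.choose 5 * 2 ^ 14 + n.choose 4 * 2 ^ 6 +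
      n.choose 3 * 2 ^ 3 + n.choose 2 * 2 + n + 1) * (n + 1) := by
  have h10 := choose_succ_mul_sub_nine_le n 10 (by norm_num)
  have h9 := choose_succ_mul_sub_nine_le n 9 (by norm_num)
  have h8 := choose_succ_mul_sub_nine_le n 8 (by norm_num)
  have h7 := choose_succ_mul_sub_nine_le n 7 (by norm_num)
  have h6 := choose_succ_mul_sub_nine_le n 6 (by norm_num)
  have h5 := choose_succ_mul_sub_nine_le n 5 (by norm_num)
  have h4 := choose_succ_mul_sub_nine_le n 4 (by norm_num)
  have h3 := choose_succ_mul_sub_nine_le n 3 (by norm_num)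
  have h2 := choose_succ_mul_sub_nine_le n 2 (by norm_num)
  have h1 : (n + 1) * (n - 9) ≤ n * (n + 1) := by
    calc (n + 1) * (n - 9) = (n - 9) * (n + 1) := by ring
      _ ≤ n * (n + 1) := Nat.mul_le_mul_right _ (by omega)
  have h0 : 1 * (n - 9) ≤ 1 * (n + 1) := by omega
  calc ((n + 1).choose 10 * 2 ^ 629 + (n + 1).choose 9 * 2 ^ 310 + (n + 1).choose 8 * 2 ^ 151 + (n + 1).choose 7 * 2 ^ 72 + (n + 1).choose 6 * 2 ^ 33 + (n + 1).choose 5 * 2 ^ 14 + (n + 1).choose 4 * 2 ^ 6 +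
        (n + 1).choose 3 * 2 ^ 3 + (n + 1).choose 2 * 2 + (n + 1) + 1) * (n - 9)
      = ((n + 1).choose 10 * (n - 9)) * 2 ^ 629 + ((n + 1).choose 9 * (n - 9)) * 2 ^ 310 + ((n + 1).choose 8 * (n - 9)) * 2 ^ 151 + ((n + 1).choose 7 * (n - 9)) * 2 ^ 72 + ((n + 1).choose 6 * (n - 9)) * 2 ^ 33 +
        ((n + 1).choose 5 * (n - 9)) * 2 ^ 14 + ((n + 1).choose 4 * (n - 9)) * 2 ^ 6 +
        ((n + 1).choose 3 * (n - 9)) * 2 ^ 3 + ((n + 1).choose 2 * (n - 9)) * 2 + (n + 1) * (n - 9) +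
        1 * (n - 9) := by ring
    _ ≤ (n.choose 10 * (n + 1)) * 2 ^ 629 + (n.choose 9 * (n + 1)) * 2 ^ 310 + (n.choose 8 * (n + 1)) * 2 ^ 151 + (n.choose 7 * (n + 1)) * 2 ^ 72 + (n.choose 6 * (n + 1)) * 2 ^ 33 +
        (n.choose 5 * (n + 1)) * 2 ^ 14 + (n.choose 4 * (n + 1)) * 2 ^ 6 +
        (n.choose 3 * (n + 1)) * 2 ^ 3 + (n.choose 2 * (n + 1)) * 2 + n * (n + 1) + 1 * (n + 1) := by
        gcongr
    _ = (n.choose 10 * 2 ^ 629 + n.choose 9 * 2 ^ 310 + n.choose 8 * 2 ^ 151 + n.choose 7 * 2 ^ 72 + n.choose 6 * 2 ^ 33 + n.choose 5 * 2 ^ 14 + n.choose 4 * 2 ^ 6 +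
        n.choose 3 * 2 ^ 3 + n.choose 2 * 2 + n + 1) * (n + 1) := by ring

/-- **The flat tail at most doubles**: `R₁₀(n+1) ≤ 2·R₁₀(n)` for `n ≥ 20`. -/
theorem flatTail_ten_succ_le_two_mul (n : ℕ) (hn : 20 ≤ n) :
    (n + 1).choose 10 * 2 ^ 629 + (n + 1).choose 9 * 2 ^ 310 + (n + 1).choose 8 * 2 ^ 151 + (n + 1).choose 7 * 2 ^ 72 + (n + 1).choose 6 * 2 ^ 33 + (n + 1).choose 5 * 2 ^ 14 + (n + 1).choose 4 * 2 ^ 6 +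
      (n + 1).choose 3 * 2 ^ 3 + (n + 1).choose 2 * 2 + (n + 1) + 1 ≤
    2 * (n.choose 10 * 2 ^ 629 + n.choose 9 * 2 ^ 310 + n.choose 8 * 2 ^ 151 + n.choose 7 * 2 ^ 72 + n.choose 6 * 2 ^ 33 + n.choose 5 * 2 ^ 14 + n.choose 4 * 2 ^ 6 +
      n.choose 3 * 2 ^ 3 + n.choose 2 * 2 + n + 1) := by
  have h10 := choose_succ_le_two_mul_of_two_mul_le_cube n 10 (by omega)
  have h9 := choose_succ_le_two_mul_of_two_mul_le_cube n 9 (by omega)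
  have h8 := choose_succ_le_two_mul_of_two_mul_le_cube n 8 (by omega)
  have h7 := choose_succ_le_two_mul_of_two_mul_le_cube n 7 (by omega)
  have h6 := choose_succ_le_two_mul_of_two_mul_le_cube n 6 (by omega)
  have h5 := choose_succ_le_two_mul_of_two_mul_le_cube n 5 (by omega)
  have h4 := choose_succ_le_two_mul_of_two_mul_le_cube n 4 (by omega)
  have h3 := choose_succ_le_two_mul_of_two_mul_le_cube n 3 (by omega)
  have h2 := choose_succ_le_two_mul_of_two_mul_le_cube n 2 (by omega)
  nlinarith [h10, h9, h8, h7, h6, h5, h4, h3, h2]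

/-- The mid sum grows by at least the factor `(n + 1)/(n − 9)`: `Σ_{k ∈ Ico 10 p} C(n, k)·(n + 1) ≤ Σ_{k ∈ Ico 10 p} C(n+1, k)·(n − 8)`. -/
theorem sum_Ico_choose_mul_succ_le_sum_succ_mul_sub_nine_ten (n p : ℕ) :
    (∑ k ∈ Finset.Ico 10 p, n.choose k) * (n + 1) ≤ (∑ k ∈ Finset.Ico 10 p, (n + 1).choose k) * (n - 9) := by
  rw [Finset.sum_mul, Finset.sum_mul]
  apply Finset.sum_le_sum
  intro k hk
  rw [Finset.mem_Ico] at hk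
  exact choose_mul_succ_le_choose_succ_mul_sub_nine n k hk.1

/-- **Pascal on the mid sum**: `Σ_{k ∈ Ico 10 (p+1)} C(n+1, k) = 2·Σ_{k ∈ Ico 10 p} C(n, k) + C(n, p) + C(n, 9)` for `10 ≤ p`. -/
theorem sum_Ico_choose_succ_eq_two_mul_add_ten (n p : ℕ) (hp : 10 ≤ p) :
    ∑ k ∈ Finset.Ico 10 (p + 1), (n + 1).choose k =
      2 * ∑ k ∈ Finset.Ico 10 p, n.choose k + n.choose p + n.choose 9 := by
  induction p, hp using Nat.le_induction with
  | base =>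
    rw [Finset.sum_Ico_succ_top (le_refl 10), Finset.Ico_self, Finset.sum_empty, Finset.sum_empty,
      show (10 : ℕ) = 9 + 1 from rfl, Nat.choose_succ_succ]
    ring
  | succ p hp ih =>
    rw [Finset.sum_Ico_succ_top (by omega : 10 ≤ p + 1), ih, Finset.sum_Ico_succ_top (by omega : 10 ≤ p),
      Nat.choose_succ_succ]
    ring

/-- The mid sum at least doubles: `2·Σ_{k ∈ Ico 10 p} C(n, k) ≤ Σ_{k ∈ Ico 10 (p+1)} C(n+1, k)` for `10 ≤ p`. -/
theorem two_mul_sum_Ico_choose_le_sum_succ_ten (n p : ℕ) (hp : 10 ≤ p) :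
    2 * ∑ k ∈ Finset.Ico 10 p, n.choose k ≤ ∑ k ∈ Finset.Ico 10 (p + 1), (n + 1).choose k := by
  rw [sum_Ico_choose_succ_eq_two_mul_add_ten n p hp]
  omega

/-- `C(n+1, 10)·C(p+10, 10) ≤ C(n, 10)·C(p+11, 10)` once `p + 10 ≤ n` (the ratio `(n+1)(p+1)/((n−9)(p+11)) ≤ 1`). -/
theorem choose_succ_ten_mul_le (n p : ℕ) (hn : p + 10 ≤ n) :
    (n + 1).choose 10 * (p + 10).choose 10 ≤ n.choose 10 * (p + 11).choose 10 := by
  have e1 := choose_succ_ten_mul_sub_nine n (by omega)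
  have e2 : (p + 11).choose 10 * (p + 1) = (p + 10).choose 10 * (p + 11) := by
    have h := Nat.choose_mul_succ_eq (p + 10) 10
    rw [show p + 10 + 1 - 10 = p + 1 by omega, show p + 10 + 1 = p + 11 by omega] at h
    exact h.symm
  have hpos : 0 < (n - 9) * (p + 1) := by
    have : 0 < n - 9 := by omega
    positivity
  apply Nat.le_of_mul_le_mul_right _ hpos
  calc (n + 1).choose 10 * (p + 10).choose 10 * ((n - 9) * (p + 1))
      = ((n + 1).choose 10 * (n - 9)) * (p + 10).choose 10 * (p + 1) := by ring
    _ = (n.choose 10 * (n + 1)) * (p + 10).choose 10 * (p + 1) := by rw [e1]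
    _ = n.choose 10 * (p + 10).choose 10 * ((n + 1) * (p + 1)) := by ring
    _ ≤ n.choose 10 * (p + 10).choose 10 * ((n - 9) * (p + 11)) := by
        apply Nat.mul_le_mul_left
        have h1 : (n + 1) * (p + 1) = n * p + n + p + 1 := by ring
        have h2 : (n - 9) * (p + 11) = n * p + 11 * n - 9 * p - 99 := by
          obtain ⟨m, rfl⟩ : ∃ m, n = m + 9 := ⟨n - 9, by omega⟩
          rw [show m + 9 - 9 = m by omega]
          have : (m + 9) * p + 11 * (m + 9) - 9 * p - 99 = m * p + 11 * m := by
            have : (m + 9) * p + 11 * (m + 9) = m * p + 11 * m + 9 * p + 99 := by ring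
            omega
          rw [this]; ring
        have h3 : n * p + n + p + 1 ≤ n * p + 11 * n - 9 * p - 99 := by
          have : 10 * p + 100 ≤ 10 * n := by omega
          have h4 : n * p + 11 * n ≥ 9 * p + 99 := by nlinarith
          omega
        omega
    _ = n.choose 10 * ((p + 10).choose 10 * (p + 11)) * (n - 9) := by ring
    _ = n.choose 10 * ((p + 11).choose 10 * (p + 1)) * (n - 9) := by rw [e2]
    _ = n.choose 10 * (p + 11).choose 10 * ((n - 9) * (p + 1)) := by ring

/-- **The step in `n`**: the inequality at `(p, n)` gives it at `(p, n + 1)` for `n ≥ 10`. -/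
theorem largeTen_step_n (p n : ℕ) (hn : 10 ≤ n)
    (h : (2 : ℚ) ^ (p + 639) * (n.choose 10 : ℚ) / ((p + 10).choose 10 : ℚ) +
      ((n.choose 10 * 2 ^ 629 + n.choose 9 * 2 ^ 310 + n.choose 8 * 2 ^ 151 + n.choose 7 * 2 ^ 72 + n.choose 6 * 2 ^ 33 + n.choose 5 * 2 ^ 14 + n.choose 4 * 2 ^ 6 +
        n.choose 3 * 2 ^ 3 + n.choose 2 * 2 + n + 1 : ℕ) : ℚ) ≤
      ((∑ k ∈ Finset.Ico 10 p, n.choose k : ℕ) : ℚ)) :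
    (2 : ℚ) ^ (p + 639) * ((n + 1).choose 10 : ℚ) / ((p + 10).choose 10 : ℚ) +
    (((n + 1).choose 10 * 2 ^ 629 + (n + 1).choose 9 * 2 ^ 310 + (n + 1).choose 8 * 2 ^ 151 + (n + 1).choose 7 * 2 ^ 72 + (n + 1).choose 6 * 2 ^ 33 + (n + 1).choose 5 * 2 ^ 14 + (n + 1).choose 4 * 2 ^ 6 +
      (n + 1).choose 3 * 2 ^ 3 + (n + 1).choose 2 * 2 + (n + 1) + 1 : ℕ) : ℚ) ≤
    ((∑ k ∈ Finset.Ico 10 p, (n + 1).choose k : ℕ) : ℚ) := by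
  have hc : (0 : ℚ) < ((p + 10).choose 10 : ℚ) := by exact_mod_cast Nat.choose_pos (by omega)
  have hm : (0 : ℚ) < ((n - 9 : ℕ) : ℚ) := by exact_mod_cast (show 0 < n - 9 by omega)
  have e7 : (((n + 1).choose 10 : ℕ) : ℚ) * ((n - 9 : ℕ) : ℚ) = (n.choose 10 : ℚ) * ((n + 1 : ℕ) : ℚ) := by
    exact_mod_cast choose_succ_ten_mul_sub_nine n (by omega)
  have hR : (((n + 1).choose 10 * 2 ^ 629 + (n + 1).choose 9 * 2 ^ 310 + (n + 1).choose 8 * 2 ^ 151 + (n + 1).choose 7 * 2 ^ 72 + (n + 1).choose 6 * 2 ^ 33 + (n + 1).choose 5 * 2 ^ 14 +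
      (n + 1).choose 4 * 2 ^ 6 + (n + 1).choose 3 * 2 ^ 3 + (n + 1).choose 2 * 2 + (n + 1) + 1 : ℕ) : ℚ) *
      ((n - 9 : ℕ) : ℚ) ≤
      ((n.choose 10 * 2 ^ 629 + n.choose 9 * 2 ^ 310 + n.choose 8 * 2 ^ 151 + n.choose 7 * 2 ^ 72 + n.choose 6 * 2 ^ 33 + n.choose 5 * 2 ^ 14 + n.choose 4 * 2 ^ 6 +
        n.choose 3 * 2 ^ 3 + n.choose 2 * 2 + n + 1 : ℕ) : ℚ) * ((n + 1 : ℕ) : ℚ) := by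
    exact_mod_cast flatTail_ten_succ_mul_sub_nine_le n
  have hS : ((∑ k ∈ Finset.Ico 10 p, n.choose k : ℕ) : ℚ) * ((n + 1 : ℕ) : ℚ) ≤
      ((∑ k ∈ Finset.Ico 10 p, (n + 1).choose k : ℕ) : ℚ) * ((n - 9 : ℕ) : ℚ) := by
    exact_mod_cast sum_Ico_choose_mul_succ_le_sum_succ_mul_sub_nine_ten n p
  -- multiply the target by `n − 8 > 0`
  apply le_of_mul_le_mul_right _ hm
  have hT : (2 : ℚ) ^ (p + 639) * (((n + 1).choose 10 : ℕ) : ℚ) / ((p + 10).choose 10 : ℚ) * ((n - 9 : ℕ) : ℚ) =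
      (2 : ℚ) ^ (p + 639) * (n.choose 10 : ℚ) / ((p + 10).choose 10 : ℚ) * ((n + 1 : ℕ) : ℚ) := by
    rw [mul_div_assoc, mul_div_assoc, mul_assoc, mul_assoc, div_mul_eq_mul_div, div_mul_eq_mul_div, e7]
  calc ((2 : ℚ) ^ (p + 639) * (((n + 1).choose 10 : ℕ) : ℚ) / ((p + 10).choose 10 : ℚ) +
        (((n + 1).choose 10 * 2 ^ 629 + (n + 1).choose 9 * 2 ^ 310 + (n + 1).choose 8 * 2 ^ 151 + (n + 1).choose 7 * 2 ^ 72 + (n + 1).choose 6 * 2 ^ 33 + (n + 1).choose 5 * 2 ^ 14 +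
          (n + 1).choose 4 * 2 ^ 6 + (n + 1).choose 3 * 2 ^ 3 + (n + 1).choose 2 * 2 + (n + 1) + 1 : ℕ) : ℚ)) *
        ((n - 9 : ℕ) : ℚ)
      = (2 : ℚ) ^ (p + 639) * (((n + 1).choose 10 : ℕ) : ℚ) / ((p + 10).choose 10 : ℚ) * ((n - 9 : ℕ) : ℚ) +
        (((n + 1).choose 10 * 2 ^ 629 + (n + 1).choose 9 * 2 ^ 310 + (n + 1).choose 8 * 2 ^ 151 + (n + 1).choose 7 * 2 ^ 72 + (n + 1).choose 6 * 2 ^ 33 + (n + 1).choose 5 * 2 ^ 14 +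
          (n + 1).choose 4 * 2 ^ 6 + (n + 1).choose 3 * 2 ^ 3 + (n + 1).choose 2 * 2 + (n + 1) + 1 : ℕ) : ℚ) *
        ((n - 9 : ℕ) : ℚ) := by ring
    _ ≤ (2 : ℚ) ^ (p + 639) * (n.choose 10 : ℚ) / ((p + 10).choose 10 : ℚ) * ((n + 1 : ℕ) : ℚ) +
        ((n.choose 10 * 2 ^ 629 + n.choose 9 * 2 ^ 310 + n.choose 8 * 2 ^ 151 + n.choose 7 * 2 ^ 72 + n.choose 6 * 2 ^ 33 + n.choose 5 * 2 ^ 14 + n.choose 4 * 2 ^ 6 +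
          n.choose 3 * 2 ^ 3 + n.choose 2 * 2 + n + 1 : ℕ) : ℚ) * ((n + 1 : ℕ) : ℚ) := by
        rw [hT]; exact add_le_add le_rfl hR
    _ = ((2 : ℚ) ^ (p + 639) * (n.choose 10 : ℚ) / ((p + 10).choose 10 : ℚ) +
        ((n.choose 10 * 2 ^ 629 + n.choose 9 * 2 ^ 310 + n.choose 8 * 2 ^ 151 + n.choose 7 * 2 ^ 72 + n.choose 6 * 2 ^ 33 + n.choose 5 * 2 ^ 14 + n.choose 4 * 2 ^ 6 +
          n.choose 3 * 2 ^ 3 + n.choose 2 * 2 + n + 1 : ℕ) : ℚ)) * ((n + 1 : ℕ) : ℚ) := by ring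
    _ ≤ ((∑ k ∈ Finset.Ico 10 p, n.choose k : ℕ) : ℚ) * ((n + 1 : ℕ) : ℚ) := by
        apply mul_le_mul_of_nonneg_right h (by positivity)
    _ ≤ ((∑ k ∈ Finset.Ico 10 p, (n + 1).choose k : ℕ) : ℚ) * ((n - 9 : ℕ) : ℚ) := hS

/-- **The step in `p` along `n = p + D`**: the inequality at `(p, n)` gives it at `(p + 1, n + 1)` for `10 ≤ p`, `p + 9 ≤ n`,
`18 ≤ n`. -/
theorem largeTen_step_p (p n : ℕ) (hp : 10 ≤ p) (hn : p + 10 ≤ n) (hn20 : 20 ≤ n)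
    (h : (2 : ℚ) ^ (p + 639) * (n.choose 10 : ℚ) / ((p + 10).choose 10 : ℚ) +
      ((n.choose 10 * 2 ^ 629 + n.choose 9 * 2 ^ 310 + n.choose 8 * 2 ^ 151 + n.choose 7 * 2 ^ 72 + n.choose 6 * 2 ^ 33 + n.choose 5 * 2 ^ 14 + n.choose 4 * 2 ^ 6 +
        n.choose 3 * 2 ^ 3 + n.choose 2 * 2 + n + 1 : ℕ) : ℚ) ≤
      ((∑ k ∈ Finset.Ico 10 p, n.choose k : ℕ) : ℚ)) :
    (2 : ℚ) ^ ((p + 1) + 639) * ((n + 1).choose 10 : ℚ) / (((p + 1) + 10).choose 10 : ℚ) +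
    (((n + 1).choose 10 * 2 ^ 629 + (n + 1).choose 9 * 2 ^ 310 + (n + 1).choose 8 * 2 ^ 151 + (n + 1).choose 7 * 2 ^ 72 + (n + 1).choose 6 * 2 ^ 33 + (n + 1).choose 5 * 2 ^ 14 + (n + 1).choose 4 * 2 ^ 6 +
      (n + 1).choose 3 * 2 ^ 3 + (n + 1).choose 2 * 2 + (n + 1) + 1 : ℕ) : ℚ) ≤
    ((∑ k ∈ Finset.Ico 10 (p + 1), (n + 1).choose k : ℕ) : ℚ) := by
  have hc : (0 : ℚ) < ((p + 10).choose 10 : ℚ) := by exact_mod_cast Nat.choose_pos (by omega)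
  have hc' : (0 : ℚ) < ((p + 1 + 10).choose 10 : ℚ) := by exact_mod_cast Nat.choose_pos (by omega)
  -- (a) the first term at most doubles
  have ha : (2 : ℚ) ^ (p + 1 + 639) * (((n + 1).choose 10 : ℕ) : ℚ) / ((p + 1 + 10).choose 10 : ℚ) ≤
      2 * ((2 : ℚ) ^ (p + 639) * (n.choose 10 : ℚ) / ((p + 10).choose 10 : ℚ)) := by
    have hk : (((n + 1).choose 10 : ℕ) : ℚ) * ((p + 10).choose 10 : ℚ) ≤ (n.choose 10 : ℚ) * ((p + 11).choose 10 : ℚ) := by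
      exact_mod_cast choose_succ_ten_mul_le n p hn
    have hc9 : (0 : ℚ) < ((p + 11).choose 10 : ℚ) := by exact_mod_cast Nat.choose_pos (by omega)
    have e1 : (2 : ℚ) ^ (p + 1 + 639) * (((n + 1).choose 10 : ℕ) : ℚ) / ((p + 1 + 10).choose 10 : ℚ) =
        ((2 : ℚ) ^ (p + 640) / (((p + 10).choose 10 : ℚ) * ((p + 11).choose 10 : ℚ))) *
          ((((n + 1).choose 10 : ℕ) : ℚ) * ((p + 10).choose 10 : ℚ)) := by
      rw [show p + 1 + 10 = p + 11 by ring, show p + 1 + 639 = p + 640 by ring]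
      field_simp
    have e2 : 2 * ((2 : ℚ) ^ (p + 639) * (n.choose 10 : ℚ) / ((p + 10).choose 10 : ℚ)) =
        ((2 : ℚ) ^ (p + 640) / (((p + 10).choose 10 : ℚ) * ((p + 11).choose 10 : ℚ))) *
          ((n.choose 10 : ℚ) * ((p + 11).choose 10 : ℚ)) := by
      rw [show p + 640 = p + 639 + 1 by ring, pow_succ]
      field_simp
      ring
    rw [e1, e2]
    exact mul_le_mul_of_nonneg_left hk (by positivity)
  -- (b) the flat tail at most doubles
  have hb : (((n + 1).choose 10 * 2 ^ 629 + (n + 1).choose 9 * 2 ^ 310 + (n + 1).choose 8 * 2 ^ 151 + (n + 1).choose 7 * 2 ^ 72 + (n + 1).choose 6 * 2 ^ 33 + (n + 1).choose 5 * 2 ^ 14 +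
      (n + 1).choose 4 * 2 ^ 6 + (n + 1).choose 3 * 2 ^ 3 + (n + 1).choose 2 * 2 + (n + 1) + 1 : ℕ) : ℚ) ≤
      2 * ((n.choose 10 * 2 ^ 629 + n.choose 9 * 2 ^ 310 + n.choose 8 * 2 ^ 151 + n.choose 7 * 2 ^ 72 + n.choose 6 * 2 ^ 33 + n.choose 5 * 2 ^ 14 + n.choose 4 * 2 ^ 6 +
        n.choose 3 * 2 ^ 3 + n.choose 2 * 2 + n + 1 : ℕ) : ℚ) := by
    exact_mod_cast flatTail_ten_succ_le_two_mul n hn20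
  -- (c) the mid sum at least doubles
  have hcc : 2 * ((∑ k ∈ Finset.Ico 10 p, n.choose k : ℕ) : ℚ) ≤
      ((∑ k ∈ Finset.Ico 10 (p + 1), (n + 1).choose k : ℕ) : ℚ) := by
    exact_mod_cast two_mul_sum_Ico_choose_le_sum_succ_ten n p hp
  calc (2 : ℚ) ^ (p + 1 + 639) * (((n + 1).choose 10 : ℕ) : ℚ) / ((p + 1 + 10).choose 10 : ℚ) +
        (((n + 1).choose 10 * 2 ^ 629 + (n + 1).choose 9 * 2 ^ 310 + (n + 1).choose 8 * 2 ^ 151 + (n + 1).choose 7 * 2 ^ 72 + (n + 1).choose 6 * 2 ^ 33 + (n + 1).choose 5 * 2 ^ 14 +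
          (n + 1).choose 4 * 2 ^ 6 + (n + 1).choose 3 * 2 ^ 3 + (n + 1).choose 2 * 2 + (n + 1) + 1 : ℕ) : ℚ)
      ≤ 2 * ((2 : ℚ) ^ (p + 639) * (n.choose 10 : ℚ) / ((p + 10).choose 10 : ℚ)) +
        2 * ((n.choose 10 * 2 ^ 629 + n.choose 9 * 2 ^ 310 + n.choose 8 * 2 ^ 151 + n.choose 7 * 2 ^ 72 + n.choose 6 * 2 ^ 33 + n.choose 5 * 2 ^ 14 + n.choose 4 * 2 ^ 6 +
          n.choose 3 * 2 ^ 3 + n.choose 2 * 2 + n + 1 : ℕ) : ℚ) := add_le_add ha hb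
    _ = 2 * ((2 : ℚ) ^ (p + 639) * (n.choose 10 : ℚ) / ((p + 10).choose 10 : ℚ) +
        ((n.choose 10 * 2 ^ 629 + n.choose 9 * 2 ^ 310 + n.choose 8 * 2 ^ 151 + n.choose 7 * 2 ^ 72 + n.choose 6 * 2 ^ 33 + n.choose 5 * 2 ^ 14 + n.choose 4 * 2 ^ 6 +
          n.choose 3 * 2 ^ 3 + n.choose 2 * 2 + n + 1 : ℕ) : ℚ)) := by ring
    _ ≤ 2 * ((∑ k ∈ Finset.Ico 10 p, n.choose k : ℕ) : ℚ) := mul_le_mul_of_nonneg_left h (by norm_num)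
    _ ≤ ((∑ k ∈ Finset.Ico 10 (p + 1), (n + 1).choose k : ℕ) : ℚ) := hcc


end ThmN

end PercRepro
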